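import Mathlib
import Literature.Computability.AlgebraicComplexity.ArithCircuitProofs

/-!
# `DivisionGap.PerMultiplesHard` (stmt-ValiantsHypothesis-5068), line `uncharged-face-walk`:
the pure exponents of a typed product inject into the product of the level slices
(stub `stub_pureLevelProduct`)

The counting heart of the DEEP PURE COUNT.  Let `a, b ∈ ℝ≥0[x_ij]` (`m × m` variables), `a`
torus-homogeneous with row margins `ρ ≤ N` (pointwise), and suppose every exponent of `a · b` has
all ROW margins `N`.  An exponent `M` is PURE when it is supported inside the graph `{(σ j, j)}` of
a permutation `σ`; then every row of `M` has at most one nonzero cell.  Suppose sets `X v`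
(`1 ≤ v ≤ N`) contain the level-`v` slices `A.filter (ρ ·.1 = v)` of every pure exponent `A` of
`a`, and `Y` contains the level-`0` slice `B.filter (ρ ·.1 = 0)` of every pure exponent `B` of `b`.
Then `#{pure exponents of a · b} ≤ (Π_{v=1}^{N} #X v) · #Y`.

Proof.  A pure exponent `M` of `a · b` is `A + B` with `A ∈ supp a`, `B ∈ supp b`
(`MvPolynomial.support_mul`), both pure (sub-exponents of a pure exponent).  The recorded pair
`((A.filter (ρ ·.1 = v))_{v ∈ [1, N]}, B.filter (ρ ·.1 = 0)) ∈ (Finset.Icc 1 N).pi X ×ˢ Y`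
RECONSTRUCTS `M` cellwise, whatever `(A, B)` was: in a row `i` with `ρ i = v ≥ 1` the row of `A`
is nonzero (row sum `v`) and sits inside the single nonzero cell of the row of `M` (value `N`), so
`M (i, j) = N · [A (i, j) ≠ 0] = N · [(A.filter (ρ ·.1 = v)) (i, j) ≠ 0]`; in a row with
`ρ i = 0` the row of `A` vanishes, so `M (i, j) = B (i, j) = (B.filter (ρ ·.1 = 0)) (i, j)`.
Hence the pure exponents of `a · b` lie in the image of `(Finset.Icc 1 N).pi X ×ˢ Y` under the
reconstruction map, whose card is `(Π_v #X v) · #Y` (`Finset.card_pi`, `Finset.card_product`,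
`Finset.card_le_card_of_surjOn`).

Log (stub-worker): pure finite combinatorics over Mathlib (`Finsupp.filter`, `Finset.pi`). [folklore]
-/

noncomputable section

open MvPolynomial Literature.Computability.AlgebraicComplexity
open scoped NNReal BigOperators

namespace Summit.ValiantsHypothesis.ValiantsHypothesis.Theorems.DivisionGap.PerMultiplesHard.PureLevelProduct

variable {m : ℕ}

/-! ### Rows of pure exponents -/

/-- In a PURE exponent `M` (supported inside the graph `{(σ j, j)}` of a permutation `σ`) every row
has at most one nonzero cell, so a nonzero cell of row `i` carries the whole row sum. [folklore] -/
theorem apply_eq_rowSum_of_pure {M : (Fin m × Fin m) →₀ ℕ} {σ : Equiv.Perm (Fin m)}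
    (hM : ∀ e ∈ M.support, e.1 = σ e.2) {i j : Fin m} (hj : M (i, j) ≠ 0) :
    M (i, j) = ∑ j', M (i, j') := by
  rw [Finset.sum_eq_single j]
  · intro j' _ hj'
    by_contra h
    exact hj' (σ.injective ((hM (i, j') (Finsupp.mem_support_iff.2 h)).symm.trans
      (hM (i, j) (Finsupp.mem_support_iff.2 hj))))
  · exact fun h => absurd (Finset.mem_univ j) h

/-- **Row reconstruction.**  If `M = A + B` is pure with row sum `N` in row `i` and row `i` of `A`
is nonzero, then row `i` of `M` is read off from row `i` of `A`: `M (i, j) = N · [A (i, j) ≠ 0]`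
(the nonzero cells of `A` in row `i` are nonzero cells of `M`, and there is only one). [folklore] -/
theorem apply_eq_ite_of_pure {M A B : (Fin m × Fin m) →₀ ℕ} {σ : Equiv.Perm (Fin m)}
    (hM : ∀ e ∈ M.support, e.1 = σ e.2) (hAB : A + B = M) {N : ℕ} {i : Fin m}
    (hrow : ∑ j, M (i, j) = N) (hA : ∑ j, A (i, j) ≠ 0) (j : Fin m) :
    M (i, j) = if A (i, j) = 0 then 0 else N := by
  have hle : ∀ j', A (i, j') ≤ M (i, j') := fun j' => by
    rw [← hAB, Finsupp.add_apply]
    exact Nat.le_add_right _ _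
  split_ifs with h
  · -- `A (i, j) = 0`: the nonzero cell `(i, j')` of row `i` of `A` is the nonzero cell of `M`
    by_contra hMij
    obtain ⟨j', -, hj'⟩ := Finset.exists_ne_zero_of_sum_ne_zero hA
    have hMij' : M (i, j') ≠ 0 := fun h0 => hj' (Nat.eq_zero_of_le_zero ((hle j').trans_eq h0))
    have hjj' : j = j' := σ.injective ((hM (i, j) (Finsupp.mem_support_iff.2 hMij)).symm.trans
      (hM (i, j') (Finsupp.mem_support_iff.2 hMij')))
    subst hjj'
    exact hj' h
  · rw [← hrow]
    exact apply_eq_rowSum_of_pure hM fun h0 => h (Nat.eq_zero_of_le_zero ((hle j).trans_eq h0))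

/-! ### The stub -/

/-- **The pure exponents of a typed product inject into the product of the level slices** (stub
`stub_pureLevelProduct` of line `uncharged-face-walk`).  Let `a` be torus-homogeneous with row
margins `ρ ≤ N` and let every exponent of `a · b` have all row margins `N`.  If the sets `X v`
(`1 ≤ v ≤ N`) contain the level-`v` slices of the pure exponents of `a` and `Y` contains the
level-`0` slices of the pure exponents of `b`, then `#{pure exponents of a · b} ≤ (Π_v #X v) · #Y`:
every pure exponent `M = A + B` of `a · b` is reconstructed cellwise from the recorded slices of
`(A, B)` — `M (i, j) = N · [A (i, j) ≠ 0]` in a row with `ρ i ≥ 1`, `M (i, j) = B (i, j)` in a row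
with `ρ i = 0`. [folklore] -/
theorem stub_pureLevelProduct :
    ∀ (m N : ℕ) (a b : MvPolynomial (Fin m × Fin m) ℝ≥0) (ρ γ : Fin m → ℕ),
      (∀ M ∈ a.support, (∀ i, ∑ j, M (i, j) = ρ i) ∧ (∀ j, ∑ i, M (i, j) = γ j)) →
      (∀ i, ρ i ≤ N) →
      (∀ M ∈ (a * b).support, ∀ i, ∑ j, M (i, j) = N) →
      ∀ (X : ℕ → Finset ((Fin m × Fin m) →₀ ℕ)) (Y : Finset ((Fin m × Fin m) →₀ ℕ)),
        (∀ A ∈ a.support, (∃ σ : Equiv.Perm (Fin m), ∀ e ∈ A.support, e.1 = σ e.2) →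
          ∀ v ∈ Finset.Icc 1 N, A.filter (fun e => ρ e.1 = v) ∈ X v) →
        (∀ B ∈ b.support, (∃ σ : Equiv.Perm (Fin m), ∀ e ∈ B.support, e.1 = σ e.2) →
          B.filter (fun e => ρ e.1 = 0) ∈ Y) →
        ((a * b).support.filter fun M => ∃ σ : Equiv.Perm (Fin m), ∀ e ∈ M.support, e.1 = σ e.2).card ≤
          (∏ v ∈ Finset.Icc 1 N, (X v).card) * Y.card := by
  intro m N a b ρ γ ha hρ hab X Y hX hY
  classical
  -- the reconstruction map: from a recorded pair of slices back to the exponent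
  let R : ((v : ℕ) → v ∈ Finset.Icc 1 N → ((Fin m × Fin m) →₀ ℕ)) × ((Fin m × Fin m) →₀ ℕ) →
      ((Fin m × Fin m) →₀ ℕ) := fun p =>
    Finsupp.equivFunOnFinite.symm fun e =>
      if h : ρ e.1 ∈ Finset.Icc 1 N then (if p.1 (ρ e.1) h e = 0 then 0 else N) else p.2 e
  calc ((a * b).support.filter
          fun M => ∃ σ : Equiv.Perm (Fin m), ∀ e ∈ M.support, e.1 = σ e.2).card
      ≤ ((Finset.Icc 1 N).pi X ×ˢ Y).card := Finset.card_le_card_of_surjOn R ?_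
    _ = (∏ v ∈ Finset.Icc 1 N, (X v).card) * Y.card := by
      rw [Finset.card_product, Finset.card_pi]
  -- every pure exponent `M = A + B` of `a * b` is reconstructed from the recorded slices of `(A, B)`
  intro M hM
  obtain ⟨hMab, σ, hσ⟩ := Finset.mem_filter.1 (Finset.mem_coe.1 hM)
  obtain ⟨A, hA, B, hB, hABM⟩ := Finset.mem_add.1 (MvPolynomial.support_mul a b hMab)
  have hle : ∀ e, A e ≤ M e ∧ B e ≤ M e := fun e => by
    rw [← hABM, Finsupp.add_apply]
    exact ⟨Nat.le_add_right _ _, Nat.le_add_left _ _⟩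
  -- sub-exponents of a pure exponent are pure
  have hApure : ∃ σ : Equiv.Perm (Fin m), ∀ e ∈ A.support, e.1 = σ e.2 :=
    ⟨σ, fun e he => hσ e (Finsupp.mem_support_iff.2 fun h0 =>
      Finsupp.mem_support_iff.1 he (Nat.eq_zero_of_le_zero ((hle e).1.trans_eq h0)))⟩
  have hBpure : ∃ σ : Equiv.Perm (Fin m), ∀ e ∈ B.support, e.1 = σ e.2 :=
    ⟨σ, fun e he => hσ e (Finsupp.mem_support_iff.2 fun h0 =>
      Finsupp.mem_support_iff.1 he (Nat.eq_zero_of_le_zero ((hle e).2.trans_eq h0)))⟩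
  refine ⟨(fun v _ => A.filter (fun e => ρ e.1 = v), B.filter (fun e => ρ e.1 = 0)), ?_, ?_⟩
  · exact Finset.mem_coe.2 (Finset.mem_product.2
      ⟨Finset.mem_pi.2 fun v hv => hX A hA hApure v hv, hY B hB hBpure⟩)
  · ext ⟨i, j⟩
    simp only [R, Finsupp.coe_equivFunOnFinite_symm]
    by_cases hi : ρ i ∈ Finset.Icc 1 N
    · -- a row of positive level `ρ i`: `M (i, j) = N · [A (i, j) ≠ 0]`
      have h1 : (A.filter fun e : Fin m × Fin m => ρ e.1 = ρ i) (i, j) = A (i, j) :=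
        Finsupp.filter_apply_pos _ _ rfl
      rw [dif_pos hi, h1]
      refine (apply_eq_ite_of_pure hσ hABM (hab M hMab i) ?_ j).symm
      rw [(ha A hA).1 i]
      exact Nat.one_le_iff_ne_zero.1 (Finset.mem_Icc.1 hi).1
    · -- a row of level `0`: the row of `A` vanishes, `M (i, j) = B (i, j)`
      have hρi : ρ i = 0 := by
        by_contra h0
        exact hi (Finset.mem_Icc.2 ⟨Nat.one_le_iff_ne_zero.2 h0, hρ i⟩)
      have h1 : (B.filter fun e : Fin m × Fin m => ρ e.1 = 0) (i, j) = B (i, j) :=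
        Finsupp.filter_apply_pos _ _ hρi
      have hAi : A (i, j) = 0 := by
        have h := (ha A hA).1 i
        rw [hρi, Finset.sum_eq_zero_iff] at h
        exact h j (Finset.mem_univ j)
      rw [dif_neg hi, h1, ← hABM, Finsupp.add_apply, hAi, zero_add]

end Summit.ValiantsHypothesis.ValiantsHypothesis.Theorems.DivisionGap.PerMultiplesHard.PureLevelProduct

end
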